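import Mathlib.AlgebraicGeometry.Morphisms.OpenImmersion
import Mathlib.AlgebraicGeometry.Cover.Open
import HarnessLib

/-!
# A ring-theoretic criterion for `Spec R → Spec R'` to be an open immersion onto `⋃ D(hᵢ)`

Topic: `Literature/AlgebraicGeometry/Limits` (used for the finite type models of
`Literature/AlgebraicGeometry/Limits/FiniteTypeModel*`: the model of an intersection of charts must be
recognised as an open subscheme of the model of a chart). For a ring homomorphism `ψ : R' → R` and
finitely many `hᵢ ∈ R'` such that

* the `ψ(hᵢ)` generate the unit ideal of `R` (i.e. `Spec R = ⋃ D(ψ hᵢ)`), and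
* each localised map `R'[1/hᵢ] → R[1/ψ hᵢ]` is bijective,

the morphism `Spec R → Spec R'` is an open immersion with image `⋃ᵢ D(hᵢ)` (`isOpenImmersion_specMap`,
`range_specMap`). Proof: open immersions can be checked on an open cover of the SOURCE together with
injectivity (Mathlib `IsOpenImmersion.of_openCover_source`); on `D(ψ hᵢ) = Spec R[1/ψ hᵢ] ≅ Spec R'[1/hᵢ]`
the morphism is the open immersion `Spec R'[1/hᵢ] → Spec R'`. This is the affine form of The Stacks
Project, Tag 01IO/Tag 04PW-type statements ("a morphism which is an isomorphism onto the members of an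
open covering of an open is an open immersion"). Everything is proved; no named facts. [folklore]

## References

* The Stacks Project, Tag 01IO (Schemes, Lemma 26.4.x, open subspaces) and Tag 01HZ. [StacksProject]
* U. Görtz, T. Wedhorn, *Algebraic Geometry I*, 2nd ed. (2020), Prop. 3.2, §(2.11). [GortzWedhorn2020]
-/

noncomputable section

universe u

open CategoryTheory AlgebraicGeometry TopologicalSpace

namespace Literature.AlgebraicGeometry.Limits

namespace SpecOpenImmersion

variable {R' R : Type u} [CommRing R'] [CommRing R] (ψ : R' →+* R) {ι : Type u} (h : ι → R')
  (hspan : Ideal.span (Set.range fun i => ψ (h i)) = ⊤)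
  (hbij : ∀ i, Function.Bijective (Localization.awayMap ψ (h i)))

/-- `Spec R'[1/r] ≅ Spec R[1/ψ r]` followed by `Spec R'[1/r] → Spec R'` is `Spec R[1/ψ r] → Spec R → Spec R'`.
[folklore] -/
theorem specMap_algebraMap_comp (r : R') :
    Spec.map (CommRingCat.ofHom (algebraMap R (Localization.Away (ψ r)))) ≫ Spec.map (CommRingCat.ofHom ψ) =
      Spec.map (CommRingCat.ofHom (Localization.awayMap ψ r)) ≫
        Spec.map (CommRingCat.ofHom (algebraMap R' (Localization.Away r))) := by
  rw [← Spec.map_comp, ← Spec.map_comp, ← CommRingCat.ofHom_comp, ← CommRingCat.ofHom_comp]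
  congr 2
  exact (IsLocalization.map_comp _).symm

include hbij in
/-- Over `D(ψ hᵢ)`, the morphism `Spec R → Spec R'` is an open immersion. [folklore] -/
theorem isOpenImmersion_comp (i : ι) :
    IsOpenImmersion (Spec.map (CommRingCat.ofHom (algebraMap R (Localization.Away (ψ (h i))))) ≫
      Spec.map (CommRingCat.ofHom ψ)) := by
  rw [specMap_algebraMap_comp]
  haveI : IsIso (CommRingCat.ofHom (Localization.awayMap ψ (h i))) :=
    (ConcreteCategory.isIso_iff_bijective _).mpr (hbij i)
  haveI : IsOpenImmersion (Spec.map (CommRingCat.ofHom (algebraMap R' (Localization.Away (h i))))) :=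
    IsOpenImmersion.of_isLocalization (h i)
  infer_instance

/-- A point of `Spec R` lies in the image of `Spec R[1/ψ r]` iff its image in `Spec R'` lies in `D(r)`.
[folklore] -/
theorem mem_range_iff (r : R') (x : Spec (CommRingCat.of R)) :
    x ∈ Set.range (Spec.map (CommRingCat.ofHom (algebraMap R (Localization.Away (ψ r))))) ↔
      Spec.map (CommRingCat.ofHom ψ) x ∈ PrimeSpectrum.basicOpen r := by
  have e : Set.range (Spec.map (CommRingCat.ofHom (algebraMap R (Localization.Away (ψ r))))) =
      (PrimeSpectrum.basicOpen (ψ r) : Set (PrimeSpectrum R)) :=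
    PrimeSpectrum.localization_away_comap_range (Localization.Away (ψ r)) (ψ r)
  rw [e]
  rfl

include hspan hbij in
/-- **The criterion**: `Spec R → Spec R'` is an open immersion. [folklore] -/
theorem isOpenImmersion_specMap : IsOpenImmersion (Spec.map (CommRingCat.ofHom ψ)) := by
  let 𝒰 := (Scheme.affineOpenCoverOfSpanRangeEqTop (R := CommRingCat.of R) (fun i => ψ (h i)) hspan).openCover
  refine IsOpenImmersion.of_openCover_source _ 𝒰 ?_ (fun i => isOpenImmersion_comp ψ h hbij i)
  intro x y hxy
  obtain ⟨i, x', rfl⟩ := 𝒰.exists_eq x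
  -- `y` lies in the same chart
  have hy : y ∈ Set.range (𝒰.f i) := by
    change y ∈ Set.range (Spec.map (CommRingCat.ofHom (algebraMap R (Localization.Away (ψ (h i))))))
    rw [mem_range_iff, ← hxy, ← mem_range_iff]
    exact ⟨x', rfl⟩
  obtain ⟨y', rfl⟩ := hy
  have hinj := (Scheme.Hom.isOpenEmbedding (f := 𝒰.f i ≫ Spec.map (CommRingCat.ofHom ψ))
    (H := isOpenImmersion_comp ψ h hbij i)).injective
  rw [← Scheme.Hom.comp_apply, ← Scheme.Hom.comp_apply] at hxy
  rw [hinj hxy]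

include hbij in
/-- **The image**: `Spec R → Spec R'` has image `⋃ᵢ D(hᵢ)` (given that the `ψ(hᵢ)` generate the unit
ideal, the image is contained in it; each `D(hᵢ)` is the image of `Spec R'[1/hᵢ] ≅ Spec R[1/ψ hᵢ]`).
[folklore] -/
theorem range_specMap (hspan : Ideal.span (Set.range fun i => ψ (h i)) = ⊤) :
    Set.range (Spec.map (CommRingCat.ofHom ψ)) = ⋃ i, (PrimeSpectrum.basicOpen (h i) : Set (PrimeSpectrum R')) := by
  let 𝒰 := (Scheme.affineOpenCoverOfSpanRangeEqTop (R := CommRingCat.of R) (fun i => ψ (h i)) hspan).openCover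
  apply Set.Subset.antisymm
  · rintro _ ⟨x, rfl⟩
    obtain ⟨i, x', rfl⟩ := 𝒰.exists_eq x
    refine Set.mem_iUnion.mpr ⟨i, (mem_range_iff ψ (h i) _).mp ⟨x', rfl⟩⟩
  · intro y hy
    obtain ⟨i, hi⟩ := Set.mem_iUnion.mp hy
    have hy' : y ∈ Set.range (Spec.map (CommRingCat.ofHom (algebraMap R' (Localization.Away (h i))))) := by
      have e : Set.range (Spec.map (CommRingCat.ofHom (algebraMap R' (Localization.Away (h i))))) =
          (PrimeSpectrum.basicOpen (h i) : Set (PrimeSpectrum R')) :=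
        PrimeSpectrum.localization_away_comap_range (Localization.Away (h i)) (h i)
      rw [e]; exact hi
    obtain ⟨z, rfl⟩ := hy'
    -- `z` comes from `Spec R[1/ψ hᵢ]` along the isomorphism
    haveI : IsIso (CommRingCat.ofHom (Localization.awayMap ψ (h i))) :=
      (ConcreteCategory.isIso_iff_bijective _).mpr (hbij i)
    obtain ⟨w, rfl⟩ : z ∈ Set.range (Spec.map (CommRingCat.ofHom (Localization.awayMap ψ (h i)))) :=
      ⟨inv (Spec.map (CommRingCat.ofHom (Localization.awayMap ψ (h i)))) z, by
        rw [← Scheme.Hom.comp_apply, IsIso.inv_hom_id]; rfl⟩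
    refine ⟨Spec.map (CommRingCat.ofHom (algebraMap R (Localization.Away (ψ (h i))))) w, ?_⟩
    rw [← Scheme.Hom.comp_apply, specMap_algebraMap_comp, Scheme.Hom.comp_apply]

end SpecOpenImmersion

end Literature.AlgebraicGeometry.Limits

end
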